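import Summits.MatrixMultiplication.MatrixMultiplication.Theses.FidelityWitnesses
import Summits.MatrixMultiplication.MatrixMultiplication.Theorems.FidelityGapThreeSeventeen.Negative.BorderRankReduction
import Literature.RingTheory.MvPolynomial.MultigradedHilbertFunction

/-!
# Line `punctual-saturation` for crux `FidelityWitnesses.FidelityGapThreeSeventeen` (stmt-MatrixMultiplication-4958)

Skeleton (crux-plan, planner-cruxplan-stmt-MatrixMultiplication-4958-punctual-saturation-0, 2026-08-16) of
idea card `Cruxes/FidelityGapThreeSeventeen/Ideas/punctual-saturation.md` (crux-ideate r1, ideator 3; triage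
r1-1/2/3: **pass** ×3, merge-adjacent to `sticky-saturation-slip`; sharpenings built in, see the line card
`Lines/punctual-saturation.md`).

THE CRUX. `FidelityGapThreeSeventeen : ∃ ε > 0, ∀ S, tensorRank S ≤ 17 → ‖∑ S·⟨3,3,3⟩‖² ≤ (1 − ε)·27·∑‖S‖²`,
which is EXACTLY `18 ≤ R̲(⟨3,3,3⟩)` (Disproof.lean §1 `crux_iff_eighteen_le_algBorderRank`; landed:
`Theorems.algBorderRank_le_seventeen_of_not_fidelityGapThreeSeventeen`, Negative/BorderRankReduction.lean,
p73201 — imported here and used as the transfer, contrapositively).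

THE LINE (punctual saturation and sticky ideals; Buczyńska–Buczyński border apolarity + Jelisiejew–Mańdziuk).
Let `S = ℂ[C ⊕ A ⊕ B]` be the Cox ring of `ℙC × ℙA × ℙB` (`27` variables, `ℕ³`-graded; `C, A, B = ℂ^{3×3}` the
three slots of `matMulTensor ℂ 3 3 3`, `T = ⟨3,3,3⟩ ∈ C ⊗ A ⊗ B`). A CANDIDATE is a trihomogeneous ideal
`I ⊂ S` with the Hilbert function of `17` general points (`dim I_D = dim S_D − min(17, dim S_D)` for ALL
`D ∈ ℕ³`) whose `(1,1,1)`-forms are apolar to `T` (`IsCandidate`); it is a SLIP LIMIT if it is the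
degreewise limit of the ideals of a sequence of `17`-tuples of points in general position (`IsSlipLimit`,
the sequential form of `[I] ∈ Slip₁₇`, JM Def. 3.10 / BB21 §3). The Borel subgroup `B = B₃ × B₃ × B₃` of
the stabiliser `GL₃³` of `T` acts on `S` by substitution (`borelSubst`; on points
`(c, a, b) ↦ (P⁻ᵀ c R⁻ᵀ, P a Q, Q⁻¹ b R)`, which fixes `T`), with a UNIQUE fixed point
`p₀ = ([E₂₀], [E₀₂], [E₀₂])` on `ℙC × ℙA × ℙB` (corner variables `cornerVar`).
* `stub_borelFixedApolarity` (TRANSFER, K-input): `R̲(⟨3,3,3⟩) ≤ 17` ⇒ a `B`-stable candidate that is a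
  Slip limit exists (border apolarity, Buczyńska–Buczyński 2021 Thm 1.2, in the Borel-fixed normal form
  of BB21 Thm 4.3 / Conner–Harper–Landsberg 2023 §2.4; the tree has the `(110)/(210)/(120)` span side and the
  torus part only: `BorderApolarity.exists_graded_candidate_of_isApproxDecomposition`).
* `stub_punctual` (PUNCTUALITY): a `B`-stable candidate is supported at the single point `p₀`:
  every non-corner coordinate is nilpotent modulo `I^{sat}` (`IsPunctual`; Borel fixed point theorem on
  the finite `B`-stable set `V(I)`, uniqueness of the `B`-stable line in each irreducible factor — the
  card's `BorelFixedLineMatrixThree` — and the multigraded Nullstellensatz).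
* `stub_noSaturatedCandidate` (STEP 0 of the merged line, triage r1-2/r1-3 "CactusSeventeenAtCorner"): no
  `B`-stable punctual candidate is saturated — there is no `B`-stable length-`17` scheme `Z` at `p₀` with
  the generic trigraded Hilbert function and `⟨3,3,3⟩ ∈ ⟨Z⟩₁₁₁` (a finite classification of `B`-stable
  colength-`17` ideals of `𝒪_{p₀}`, `24` local coordinates; the card's falsifier (2)).
* `stub_stickySaturation` (THE LEVER, hardest): every `B`-stable punctual UNSATURATED candidate `I` admits
  a STICKY ideal `I ⊊ J ⊆ I^{sat}` (`Sticky`, the sequential form of Jelisiejew–Mańdziuk's "every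
  deformation of `I` induces a deformation of `J ⊇ I`"): certified candidate by candidate by
  `ObFib(I, I^{sat}) = Ext¹_S(I^{sat}/I, S/I^{sat})₀ = 0` (JM Thm 1.2 = 3.4, 3.6), or the tangent form
  (JM Thm 1.3 = 3.5, 3.7), or Mańdziuk's projected tangent test (arXiv:2306.08104 Prop 5.2(e), Ex. 1.6) —
  exact linear algebra over `ℚ` in the finitely many multidegrees where `I^{sat}/I` lives.
* `stub_sticky_not_slip` (JM's observation, arXiv:2210.13579 p. 4, in sequential form; provable now): a
  candidate with a sticky ideal is not a Slip limit (the ideals of points `I(Γ_k) → I` are saturated with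
  the same Hilbert function, so the induced `J'_k ⊇ I(Γ_k)` with `HF(J'_k) = HF(J)` agrees with `I(Γ_k)` in
  large degrees, hence `J'_k ⊆ I(Γ_k)^{sat} = I(Γ_k)`, forcing `HF(J) = HF(I)`, i.e. `J = I`).
* `FidelityGapThreeSeventeen_of` — the kernel-checked composition: if the crux fails, `R̲ ≤ 17`
  (Negative/BorderRankReduction), the transfer gives a `B`-stable candidate Slip limit `I`, which is punctual,
  unsaturated, carries a sticky `J`, hence is NOT a Slip limit — absurd.

Disproof.lean used (`Cruxes/FidelityGapThreeSeventeen/Disproof.lean`, refuter-cdisprove 2026-08-16): (i) §1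
`crux_iff_eighteen_le_algBorderRank` — the line proves `18 ≤ R̲` and re-enters through it (landed form
imported: `algBorderRank_le_seventeen_of_not_fidelityGapThreeSeventeen`); (ii) §2 `crux_false_without_rankBound`
/ `not_fidelityGapThree_twenty`: the rank hypothesis `17` is used exactly in `HasGenericHF` /
`InGeneralPosition` (`min 17 (dim S_D)`, `Fin 17` points) of `stub_borelFixedApolarity`; at `r = 20`
Smirnov's kernel-checked scheme yields a GENUINE Slip limit, so `stub_stickySaturation`/`stub_noSaturatedCandidate`
with `17 → 20` must fail for its Borel-fixed limit ideal — the `r = 20` guard of the line card; (iii) §3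
tightness (`ε ≤ 7/27`, Negative/Tightness.lean): the line is `ε`-ineffective (it proves `18 ≤ R̲` and
transfers through the cone-closure criterion), consistent; (iv) §4: the same skeleton with `17 → 18, 19` is the
template for the next rungs. No stub is an instance of a landed Negative lemma's hypothesis; negatives index
(`ledger negatives --problem MatrixMultiplication`: STPP designs / design flattening / Fourier families) unrelated.
-/

noncomputable section

namespace Summit.MatrixMultiplication.MatrixMultiplication.Cruxes.FidelityGapThreeSeventeen.PunctualSaturation

open scoped BigOperators Topology
open Filter MvPolynomial
open Literature.Computability.AlgebraicComplexity
open Summit.MatrixMultiplication.MatrixMultiplication.Theses.FidelityWitnesses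

set_option linter.unusedVariables false
set_option linter.dupNamespace false

/-! ## Vocabulary: the trigraded Cox ring of `ℙC × ℙA × ℙB` -/

/-- Variables of `S`: `(s, i, j)` is the coordinate `(i, j)` on slot `s` of `matMulTensor ℂ 3 3 3`
(`s = 0`: `c_{κν}` on the output slot `C`; `s = 1`: `a_{κμ}` on `A`; `s = 2`: `b_{μν}` on `B`). -/
abbrev Var : Type := Fin 3 × Fin 3 × Fin 3

/-- `S = ℂ[C ⊕ A ⊕ B]`, the Cox ring of `ℙ⁸ × ℙ⁸ × ℙ⁸` (`27` variables). -/
abbrev S : Type := MvPolynomial Var ℂ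

/-- The `ℕ³`-grading: the variable `(s, i, j)` has multidegree `e_s` (the tree's block-grading
convention `fun i => Pi.single (blk i) 1` of `MultigradedHilbertFunction.lean`, `blk = Prod.fst`). -/
def wt : Var → (Fin 3 → ℕ) := fun v => Pi.single v.1 1

/-- The piece `S_D` of multidegree `D ∈ ℕ³`. -/
abbrev SD (D : Fin 3 → ℕ) : Submodule ℂ S := weightedHomogeneousSubmodule ℂ wt D

/-- The piece `I_D = I ∩ S_D` of an ideal. -/
abbrev piece (I : Ideal S) (D : Fin 3 → ℕ) : Submodule ℂ S := Submodule.restrictScalars ℂ I ⊓ SD D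

/-- `dim_ℂ I_D`. -/
abbrev hdim (I : Ideal S) (D : Fin 3 → ℕ) : ℕ := Module.finrank ℂ ↥(piece I D)

/-- `I` is trihomogeneous (closed under taking multihomogeneous components; explicit form, no
graded-ring instance, as in `MultigradedHilbertFunction.lean`). -/
def IsTrihomog (I : Ideal S) : Prop := ∀ p ∈ I, ∀ D, weightedHomogeneousComponent wt D p ∈ I

/-- `I` has the Hilbert function of `17` points in general position:
`dim I_D + min(17, dim S_D) = dim S_D` for EVERY multidegree `D` (so `I₀ = I₁₀₀ = I₀₁₀ = I₀₀₁ = 0`,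
`codim I₁₁₀ = codim I₁₁₁ = 17`, …). This is where the rank threshold `17` of the crux enters. -/
def HasGenericHF (I : Ideal S) : Prop :=
  ∀ D, hdim I D + min 17 (Module.finrank ℂ ↥(SD D)) = Module.finrank ℂ ↥(SD D)

/-- The exponent vector of the `(1,1,1)`-monomial `c_a · a_b · b_c`. -/
def mono111 (a b c : Fin 3 × Fin 3) : Var →₀ ℕ :=
  Finsupp.single ((0 : Fin 3), a) 1 + Finsupp.single ((1 : Fin 3), b) 1 + Finsupp.single ((2 : Fin 3), c) 1

/-- The apolarity pairing of `f ∈ S` with `T = ⟨3,3,3⟩ ∈ C ⊗ A ⊗ B` through the `(1,1,1)`-coefficients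
of `f` (`T` has the entry `1` at `(a,b,c) = ((κ,ν),(κ,μ),(μ,ν))`: `⟨f, T⟩ = Σ_{κμν} coeff(c_{κν} a_{κμ} b_{μν}) f`). -/
def pairT (f : S) : ℂ :=
  ∑ a : Fin 3 × Fin 3, ∑ b : Fin 3 × Fin 3, ∑ c : Fin 3 × Fin 3,
    coeff (mono111 a b c) f * matMulTensor ℂ 3 3 3 a b c

/-- `I ⊂ Ann(T)`: the `(1,1,1)`-forms of `I` are apolar to `T` (for an ideal this implies the slice
conditions `I₁₁₀ ⊂ T(C*)^⊥` etc. in the three degrees below, and `Ann(T)_D = S_D` in all other degrees). -/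
def IsApolar (I : Ideal S) : Prop := ∀ f ∈ I, f ∈ SD (fun _ => 1) → pairT f = 0

/-- A CANDIDATE ideal of border apolarity for `(⟨3,3,3⟩, r = 17)`: trihomogeneous, generic Hilbert
function of `17` points, apolar to `T` (a `ℂ`-point of `Hilb^{h₁₇}_S` inside `{I ⊂ Ann T}`). -/
def IsCandidate (I : Ideal S) : Prop := IsTrihomog I ∧ HasGenericHF I ∧ IsApolar I

/-! ## Vocabulary: the Borel action and its fixed flag point -/

/-- Upper triangular and invertible. -/
def IsUpperUnit (P : Matrix (Fin 3) (Fin 3) ℂ) : Prop := (∀ i j, j < i → P i j = 0) ∧ IsUnit P.det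

/-- The substitution of variables induced by `g = (P, Q, R) ∈ GL₃³` acting on points of `C ⊕ A ⊕ B` by
`(c, a, b) ↦ (P⁻ᵀ c R⁻ᵀ, P a Q, Q⁻¹ b R)` (this action fixes `T = Σ E_{κν} ⊗ E_{κμ} ⊗ E_{μν}`):
a variable, i.e. a coordinate function, is sent to its composite with `g`, a linear form. -/
def borelVar (P Q R : Matrix (Fin 3) (Fin 3) ℂ) : Var → S := fun v =>
  ![∑ i' : Fin 3, ∑ j' : Fin 3, C ((P⁻¹) i' v.2.1 * (R⁻¹) v.2.2 j') * X ((0 : Fin 3), i', j'),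
    ∑ i' : Fin 3, ∑ j' : Fin 3, C (P v.2.1 i' * Q j' v.2.2) * X ((1 : Fin 3), i', j'),
    ∑ i' : Fin 3, ∑ j' : Fin 3, C ((Q⁻¹) v.2.1 i' * R j' v.2.2) * X ((2 : Fin 3), i', j')] v.1

/-- `f ↦ f ∘ g` as a `ℂ`-algebra endomorphism of `S`. -/
def borelSubst (P Q R : Matrix (Fin 3) (Fin 3) ℂ) : S →ₐ[ℂ] S := MvPolynomial.aeval (borelVar P Q R)

/-- `I` is stable under the Borel subgroup `B = B₃ × B₃ × B₃` (upper triangular `P, Q, R`) of the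
stabiliser of `T`. -/
def IsBorelStable (I : Ideal S) : Prop :=
  ∀ P Q R : Matrix (Fin 3) (Fin 3) ℂ, IsUpperUnit P → IsUpperUnit Q → IsUpperUnit R →
    ∀ f ∈ I, borelSubst P Q R f ∈ I

/-- The irrelevant ideal `S₊` of the `ℕ³`-grading, generated by the `(1,1,1)`-monomials (JM §2.4). -/
def irrel : Ideal S :=
  Ideal.span (Set.range fun abc : (Fin 3 × Fin 3) × (Fin 3 × Fin 3) × (Fin 3 × Fin 3) =>
    X ((0 : Fin 3), abc.1) * X ((1 : Fin 3), abc.2.1) * X ((2 : Fin 3), abc.2.2))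

/-- The saturation `I^{sat} = ⋃_n (I : S₊ⁿ)`. -/
def satur (I : Ideal S) : Ideal S := ⨆ n : ℕ, Submodule.colon I ((irrel ^ n : Ideal S) : Set S)

/-- The corner variables = the coordinates NOT vanishing at the unique `B`-fixed point
`p₀ = ([E₂₀], [E₀₂], [E₀₂]) ∈ ℙC × ℙA × ℙB` (`A`, `B` are sandwiched by upper triangular matrices, fixed line
`ℂ·E₀₂`; `C` by lower triangular ones, fixed line `ℂ·E₂₀`). -/
def cornerVar : Fin 3 → Var :=
  ![((0 : Fin 3), (2 : Fin 3), (0 : Fin 3)), ((1 : Fin 3), (0 : Fin 3), (2 : Fin 3)),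
    ((2 : Fin 3), (0 : Fin 3), (2 : Fin 3))]

/-- PUNCTUALITY at `p₀`: `V₊(I) ⊆ {p₀}`, i.e. every non-corner coordinate is nilpotent modulo `I^{sat}`
(`√(I^{sat}) ⊇ 𝔭₀`, the prime of `p₀`; multigraded Nullstellensatz form). -/
def IsPunctual (I : Ideal S) : Prop :=
  ∀ v : Var, v ∉ Set.range cornerVar → (X v : S) ∈ (satur I).radical

/-! ## Vocabulary: limits of ideals of points (Slip) and sticky ideals -/

/-- Affine representatives of a `17`-tuple of points of `ℙC × ℙA × ℙB`. -/
abbrev Config : Type := Fin 17 → Var → ℂ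

/-- Evaluation at the `17` points. -/
def evalAt (γ : Config) : S →ₗ[ℂ] (Fin 17 → ℂ) :=
  LinearMap.pi fun ρ => (MvPolynomial.aeval (γ ρ) : S →ₐ[ℂ] ℂ).toLinearMap

/-- `I(Γ)_D`: the `D`-forms vanishing at the `17` points (multihomogeneous, so projective vanishing). -/
def vanishPiece (γ : Config) (D : Fin 3 → ℕ) : Submodule ℂ S := LinearMap.ker (evalAt γ) ⊓ SD D

/-- The `17` points are in general position in EVERY multidegree: they impose `min(17, dim S_D)`
independent conditions on `S_D` (a countable intersection of non-empty Zariski-open conditions; over `ℂ`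
it holds off a countable union of proper closed subsets, and it follows from finitely many degrees). -/
def InGeneralPosition (γ : Config) : Prop :=
  ∀ D, Module.finrank ℂ ↥(vanishPiece γ D) + min 17 (Module.finrank ℂ ↥(SD D)) =
    Module.finrank ℂ ↥(SD D)

/-- Coefficientwise convergence of polynomials. -/
def CoeffTendsto (fseq : ℕ → S) (f : S) : Prop :=
  ∀ m : Var →₀ ℕ, Tendsto (fun k => coeff m (fseq k)) atTop (𝓝 (coeff m f))

/-- Degreewise (lower) convergence of a sequence of graded pieces to the pieces of `I`: every element
of `I_D` is a coefficientwise limit of elements of the `k`-th piece. With equal dimensions on both sides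
this is convergence in the Grassmannian of `S_D`, for every `D`. -/
def PiecesTendsto (Pk : ℕ → (Fin 3 → ℕ) → Submodule ℂ S) (I : Ideal S) : Prop :=
  ∀ D, ∀ f ∈ piece I D, ∃ fseq : ℕ → S, (∀ k, fseq k ∈ Pk k D) ∧ CoeffTendsto fseq f

/-- `Γ` witnesses that `I` is a limit of ideals of `17` points in general position. -/
def IsSlipWitness (I : Ideal S) (Γ : ℕ → Config) : Prop :=
  (∀ k, InGeneralPosition (Γ k)) ∧ PiecesTendsto (fun k => vanishPiece (Γ k)) I

/-- `[I] ∈ Slip₁₇` (sequential form of JM Def. 3.10 / Buczyńska–Buczyński): `I` is a degreewise limit of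
ideals of `17`-tuples of points in general position. -/
def IsSlipLimit (I : Ideal S) : Prop := ∃ Γ : ℕ → Config, IsSlipWitness I Γ

/-- `J` STICKS WITH `I` (Jelisiejew–Mańdziuk §1.2, sequential form): along EVERY sequence of
trihomogeneous ideals with the Hilbert function of `I` converging degreewise to `I` (every `ℂ`-point
sequence `[I_k] → [I]` of `Hilb_I`), eventually some `J' ⊇ I_k` has the Hilbert function of `J`.
Quantifying over all such sequences (not only over ideals of points) makes this a genuine
deformation-theoretic property of `[I ⊆ J] ∈ Hilb_{I ⊆ J}`, implied by smoothness of `pr_I` at `[I ⊆ J]`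
(JM Thm 3.4: `ObFib(I,J) = 0`; Thm 3.5: tangent-surjective + `[J]` smooth). -/
def Sticky (I J : Ideal S) : Prop :=
  ∀ Iseq : ℕ → Ideal S, (∀ k, IsTrihomog (Iseq k) ∧ ∀ D, hdim (Iseq k) D = hdim I D) →
    PiecesTendsto (fun k => piece (Iseq k)) I →
    ∃ k, ∃ J' : Ideal S, IsTrihomog J' ∧ Iseq k ≤ J' ∧ ∀ D, hdim J' D = hdim J D

/-! ## The stubs -/

/-- **Stub A — Borel-fixed border apolarity at `(⟨3,3,3⟩, 17)` (the TRANSFER; K-input).** If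
`R̲(⟨3,3,3⟩) ≤ 17` then some `B`-stable candidate ideal is a Slip limit.
Why plausibly true (it is a theorem in print, unformalised): an approximate decomposition over `ℂ[ε]`
(`algBorderRank`, Bläser Def. 6.1) gives rank-`17` tensors `T_t → T` with decompositions `Γ_t` that may be
perturbed into general position in every degree (as `BorderApolarityPerturb.pertX/pertY` do for
`(210)/(120)`); `[I(Γ_t)] ∈ Hilb^{h₁₇}_S` (projective, Haiman–Sturmfels) has a convergent subsequence,
its limit `I₀` is a candidate (`T_t ∈ ⟨Γ_t⟩₁₁₁ = I(Γ_t)₁₁₁^⊥` passes to the limit; dimensions are kept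
degreewise; multiplicativity is closed) and a Slip limit (continuity of every `I ↦ I_D` on the Hilbert
scheme); the closure of `B·[I₀]` inside the closed `B`-stable set of apolar Slip limits contains a
`B`-fixed point (Borel fixed point theorem, `B` connected solvable) — a `B`-stable candidate, again a
Slip limit by a diagonal-sequence argument (Buczyńska–Buczyński 2021 Thm 1.2 and Thm 4.3;
Conner–Harper–Landsberg 2023 §2.4). The tree proves the `(110)/(210)/(120)` span side with the torus part of
the normal form (`BorderApolarity.exists_graded_candidate_of_isApproxDecomposition`,
`TensorApolarity.weak_apolarity_of_decomposition`); missing: all degrees at once (compactness of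
`Hilb^{h₁₇}` or of a finite product of Grassmannians + ideal closure), the unipotent part of Borel
normalisation, the dictionary `IsApproxDecomposition ↔` sequences. Uses the rank bound `17` (Disproof §2:
load-bearing) through `Fin 17`/`min 17`. Size XL. -/
theorem stub_borelFixedApolarity :
    algBorderRank (matMulTensor ℂ 3 3 3) ≤ 17 →
      ∃ I : Ideal S, IsCandidate I ∧ IsBorelStable I ∧ IsSlipLimit I := by
  sorry

/-- **Stub P — punctuality of Borel-stable candidates.** A `B`-stable candidate is supported at the
single flag point `p₀ = ([E₂₀],[E₀₂],[E₀₂])`: every non-corner coordinate is nilpotent modulo `I^{sat}`.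
Why plausibly true: `HF(S/I)(D) = 17` for `D ≫ 0`, so `V₊(I) ⊂ ℙC × ℙA × ℙB` is finite (multigraded
Hilbert polynomial = constant `17`, `exists_hilbertMvPolynomial`); `I` is `B`-stable so `V₊(I)` is
`B`-stable; the connected group `B` acts trivially on a finite stable set, so every point of `V₊(I)` is
`B`-fixed; on each factor `ℙ(ℂ^{3×3})` the sandwich action `X ↦ P X Q` (`P, Q` invertible upper
triangular, resp. lower triangular on `C`) has a UNIQUE stable line (`ℂ·E₀₂`, resp. `ℂ·E₂₀`: the
highest-weight line of the irreducible `GL₃ × GL₃`-module — the card's first lemma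
`BorelFixedLineMatrixThree`, elementary with explicit unipotents); hence `V₊(I) ⊆ {p₀}` and the
multigraded projective Nullstellensatz (on the affine cone, Mathlib `MvPolynomial.vanishingIdeal_zeroLocus`
+ the torus `(ℂ*)³`) gives `x_v ∈ √(I^{sat})` for the `24` non-corner variables. Size L. -/
theorem stub_punctual :
    ∀ I : Ideal S, IsCandidate I → IsBorelStable I → IsPunctual I := by
  sorry

/-- **Stub N — no saturated candidate (step 0 of the line; the card's falsifier (2), triage r1-2/r1-3
"CactusSeventeenAtCorner").** A `B`-stable punctual candidate is NOT saturated: `I ≠ I^{sat}`.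
Equivalently there is no `B`-stable zero-dimensional scheme `Z` of length `17` supported at `p₀` whose
ideal `I(Z)` has the GENERIC trigraded Hilbert function `h₁₇` in every degree (in particular `Z` spans each
factor: `h_Z(1,0,0) = 9`) and `⟨3,3,3⟩ ⊥ I(Z)₁₁₁` (a border-cactus expression of `⟨3,3,3⟩` of length
`17` through a `B`-stable punctual scheme).
Why plausibly true: `I(Z)` for punctual `Z` is far from the generic Hilbert function in low degrees
(a punctual length-`17` scheme at `p₀` lies in the `16`-th infinitesimal neighbourhood, so `I(Z)` contains
NO information forcing `codim I(Z)₁₁₀ = 17` unless `Z` is very spread out, while `B`-stability confines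
`Z` to `𝔟`-stable colength-`17` ideals of `𝒪_{p₀}` in `24` weighted local coordinates — a finite
classification modulo low-dimensional families, decided by exact linear algebra); every CHL-type
candidate computed so far (`137` Borel-fixed `(110)`-data, `3522` `(111)`-triples; card baseline) has
`I₁₁₀` of codimension `17` cut out by conditions at `17` "directions", not by a fat point.
Why it might fail: such a `Z` may exist (nothing in print bounds the `B`-stable punctual cactus length of
`⟨3,3,3⟩` below `20`); then this stub is replaced by "saturated `B`-stable punctual candidates are not
Slip limits" (non-smoothability of `Z`: trivial-negative-tangents / small-tangent-space certificates,
Jelisiejew 2019), see the line card § Reshape. Size L–XL (enumeration + certificate replay). -/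
theorem stub_noSaturatedCandidate :
    ∀ I : Ideal S, IsCandidate I → IsBorelStable I → IsPunctual I → I ≠ satur I := by
  sorry

/-- **Stub St — sticky saturation (THE LEVER; hardest stub).** Every `B`-stable punctual unsaturated
candidate `I` admits a sticky ideal `J` with `I ⊊ J ⊆ I^{sat}` (expected: `J = I^{sat} = I(Z)`, `Z` the
`B`-stable length-`17` fat point at `p₀`).
Why plausibly true: by stubs P/N the saturation gap `I^{sat}/I` is a NON-ZERO module supported at `p₀`,
concentrated in the handful of low multidegrees where the candidate data live (`(1,1,0)`, `(1,0,1)`,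
`(0,1,1)`, `(1,1,1)`, `(2,1,0)`, …: `h₁₇(D) = 17` already for `D = (1,1,0)`), which is exactly the regime in
which Jelisiejew–Mańdziuk's criteria are finite linear algebra: `ObFib(I, I^{sat}) =
Ext¹_S(I^{sat}/I, S/I^{sat})₀ ≅ Hom_S(I^{sat}/I, C(I))₀ = 0` (JM Thm 3.4/3.6 with the underived form §3.1)
makes `pr_I : Hilb_{I ⊆ I^{sat}} → Hilb_I` an open immersion near `[I ⊆ I^{sat}]`, so EVERY sequence
`[I_k] → [I]` in `Hilb_I(ℂ)` (= `PiecesTendsto` + equal Hilbert function, via the Haiman–Sturmfels embedding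
into a finite product of Grassmannians) lifts eventually to `[I_k ⊆ J'_k]`, `HF(J'_k) = HF(I^{sat})` — the
definition of `Sticky`; alternatives with the same conclusion: JM Thm 3.5/3.7 (`Hom_S(J,S/J)₀ →
Hom_S(I,S/J)₀` onto and `[J]` smooth), Mańdziuk's two-factor projection + tangent test (arXiv:2306.08104
Thm 1.2, Prop 5.2(e), Ex. 1.6 on `ℙ³×ℙ³×ℙ³` where `ObFib ≠ 0` but the projected test decides). JM decide
ALL ideals with `HF (1,d,d,…)`, `d ≤ 5`, this way. Work plan: enumerate the `B`-stable punctual candidates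
through the saturation-determining degrees (input: the card's census `bapolar_n3_r17_small.json`, the
symbolic-square survivors of the sibling card), compute `I^{sat}` from the `B`-stable colength-`17` local
ideal, and replay `ObFib = 0` (a rank computation over `ℚ`) in Lean per candidate / per family with
parameters symbolic.
Why it might fail: a candidate with `ObFib ≠ 0` whose extra tangent directions integrate neither to a
saturated ideal (that would REFUTE the crux: `R̲(⟨3,3,3⟩) = 17`) nor die visibly — JM's `d = 5` exception
needed a second-order condition `((I^{sat})·J)₂ ⊆ I`; and `B`-fixed points are the most singular points of
`Hilb`, where tangent criteria are weakest (Mańdziuk Ex. 1.6 pattern: project first). Size XL. -/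
theorem stub_stickySaturation :
    ∀ I : Ideal S, IsCandidate I → IsBorelStable I → IsPunctual I → I ≠ satur I →
      ∃ J : Ideal S, IsTrihomog J ∧ I < J ∧ J ≤ satur I ∧ Sticky I J := by
  sorry

/-- **Stub JM — a candidate with a sticky ideal is not a limit of ideals of points** (Jelisiejew–Mańdziuk,
arXiv:2210.13579, p. 4 ll. 48–59 and the proof of Thm 3.4, in the sequential language of this file).
Why plausibly true (provable now): let `Γ` be a Slip witness of `I` and put `I_k :=` the trihomogeneous
ideal generated by the vanishing pieces `I(Γ_k)_D`; general position gives `HF(I_k) = h₁₇ = HF(I)` and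
`PiecesTendsto`, so stickiness yields `k` and a trihomogeneous `J' ⊇ I_k` with `HF(J') = HF(J)`. Since
`J ⊆ I^{sat}` and `I^{sat}/I` is killed by `S₊ᴺ` (Noetherian: finitely many generators), `J_D = I_D` for
`min D ≫ 0`, so `HF(S/J')(D) = HF(S/J)(D) = 17 = HF(S/I_k)(D)` there and `J'_D = (I_k)_D` for `min D ≫ 0`;
the ideal of reduced points is saturated (`(c_a a_b b_c)ᴺ f ∈ I(Γ_k)` with coordinates non-zero at a point
forces `f` to vanish there), hence `J' ⊆ (I_k)^{sat} = I_k ⊆ J'`, `HF(J) = HF(J') = HF(I_k) = HF(I)`, and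
`I ≤ J` with equal finite-dimensional pieces forces `I_D = J_D` for all `D`, i.e. `I = J` for trihomogeneous
ideals — contradicting `I < J`. Ingredients: `MultigradedHilbertFunction.lean` (pieces, finiteness
`finite_weightedHomogeneousSubmodule_of_ne_zero`), `SaturationChain.exists_saturation`-style Noetherian
stabilisation, `Submodule.eq_of_le_of_finrank_eq`. Size M–L. -/
theorem stub_sticky_not_slip :
    ∀ I J : Ideal S, IsCandidate I → IsTrihomog J → I < J → J ≤ satur I → Sticky I J →
      ¬ IsSlipLimit I := by
  sorry

/-! ## The composition (kernel-checked, no `sorry` of its own) -/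

/-- **`FidelityGapThreeSeventeen` from the five stubs.** If the crux fails then `R̲(⟨3,3,3⟩) ≤ 17`
(`Theorems.algBorderRank_le_seventeen_of_not_fidelityGapThreeSeventeen`, Negative/BorderRankReduction.lean:
cone-closure criterion + Alder's theorem, tree theorems); Borel-fixed border apolarity (stub A) gives a
`B`-stable candidate `I` that is a Slip limit; it is punctual (stub P), unsaturated (stub N), and carries a
sticky ideal `J` (stub St); by stub JM it is then NOT a Slip limit — absurd. -/
theorem FidelityGapThreeSeventeen_of : FidelityGapThreeSeventeen := by
  by_contra hcrux
  have h17 : algBorderRank (matMulTensor ℂ 3 3 3) ≤ 17 :=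
    Summit.MatrixMultiplication.MatrixMultiplication.Theorems.algBorderRank_le_seventeen_of_not_fidelityGapThreeSeventeen
      hcrux
  obtain ⟨I, hC, hB, hSlip⟩ := stub_borelFixedApolarity h17
  have hP : IsPunctual I := stub_punctual I hC hB
  have hne : I ≠ satur I := stub_noSaturatedCandidate I hC hB hP
  obtain ⟨J, hJ, hlt, hle, hst⟩ := stub_stickySaturation I hC hB hP hne
  exact stub_sticky_not_slip I J hC hJ hlt hle hst hSlip

/-! ## Sanity lemmas on the vocabulary (sorry-free; guard against vacuous definitions) -/

/-- `I ≤ I^{sat}` (the `n = 0` term of the union: `(I : S) = I`). -/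
theorem le_satur (I : Ideal S) : I ≤ satur I := by
  intro f hf
  refine Submodule.mem_iSup_of_mem 0 ?_
  rw [Submodule.mem_colon]
  intro p _
  simpa [smul_eq_mul, mul_comm] using I.mul_mem_left p hf

/-- The flag point is honest data: the three corner variables are pairwise distinct variables. -/
theorem cornerVar_injective : Function.Injective cornerVar := by
  intro i j h
  fin_cases i <;> fin_cases j <;> simp_all [cornerVar]

end Summit.MatrixMultiplication.MatrixMultiplication.Cruxes.FidelityGapThreeSeventeen.PunctualSaturation

end
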